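import Summits.ABC.IUTFork.Repair.RHSigmaCreditExact
import Summits.ABC.IUTFork.Repair.RHCreditShellBudgetSetting
import HarnessLib

/-!
# D-0121 Q1 (T-OPTIMALITY), R33(4) — THE DATUM-LEVEL FORM: the NETTING CREDIT `C(P)` of the sharp setting of record is at most the
# procession-normalised conductor-type budget `PN(i ↦ Σ_{p ∈ S₀} (1 + |S^±_{i+2}|·Σ_{v ∣ p} Pr(v)·(D_v + R_in,v − R_out,v)/e_v)·log p)`

PROOF-ONLY file (0 definitions, 0 `Prop` facts, no instance, no notation) of the abc-iut cell, rung LADDER-ABC:A2.RESCUE.H, seat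
abc-iut-rh2-T-1 (gen 4). Last link of the chain `Repair/RHCreditShellBudget` (p491053, one diagonal packet) → `Repair/RHCreditShellBudgetMixed`
(p493746, any tuple) → `Repair/RHCreditShellBudgetSetting` (p495112, the packet `(i+1, p)` of the sharp setting, place-level form) → HERE: the
datum-level number of the D-0121 netting tier, abc-iut-rh2-q2-eq's **credit** `RH.SigmaLicence.credit P := PN(i ↦ Σᶠ_{v_ℚ} (−cellDeficit_{i,v_ℚ})⁺)`
(p480491 `RHSigmaSignedRemainder`), at `P = Thm311.Real.settingPrVolSharp X …` (abc-iut-c312-7), composed BY NAME with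
abc-iut-rh2-q2-eq's `RH.SigmaStrataEq.cellDeficit_settingPrVolSharp_inl` (archimedean cells `0`, p492303 `RHSigmaCreditExact`) and
abc-iut-rh-typ-4's `RHCellSlackExactStatement.finsum_sum_eq_finsum_inr`.

WHAT IS TYPED (namespace `Summit.ABC.IUTFork.Repair.RHCreditShellBudgetDatum`).
* `neg_cellDeficit_settingPrVolSharp_inr_eq` — `−cellDeficit_{i,p} = logvol(ⁿ˒°𝒰_{i+1,p}) − qLocal_{i+1,p}` (the column of the setting is `n`; bookkeeping).
* **`credit_settingPrVolSharp_le_shellBudget`** — THE FINSUM DISCIPLINE MADE EXPLICIT (rh-lead g2 R4 / rh-ref-1 R10): for ANY finite set `S₀` of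
  primes such that the cells OFF `S₀` carry no credit (`0 ≤ cellDeficit_{i,p}` for `p ∉ S₀`; at a genuine datum `S₀ ⊇ bad(E) ∪ ram(K/ℚ)` does it —
  a hypothesis here, the tables' audit there), per-place binders at the primes (uniformisers, different exponents, inner/outer radii of
  `log_p(𝒪^×)`, Θ- and `q`-depths — p495112's block) and exact-content / outer-radius binders at every `(i, p)` (p481438's), IF every Θ-slot of
  every tuple over every `p ∈ S₀` is at least as deep as the tuple's `q`-slot, THEN
  `credit P ≤ PN(i ↦ Σ_{p ∈ S₀} (1 + |S^±_{i+2}|·Σ_{v ∣ p} (n_v/[F:ℚ])·(D_v + R_in,v − R_out,v)/e_v)·log p)`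
  — a sum of log-different + log-shell terms over the places of `F` above `S₀`, `(j+1)` slots per label, plus `Σ_{p ∈ S₀} log p` floor losses; the
  local HEIGHTS (`M`, `m_q`) do not occur. This is the D-0121 R33(4) / R38(b) sentence «the across-places credit is conductor-type» as ONE kernel
  inequality at the setting of record, under the deep-slot condition (equal pilot orders in every fibre, e.g. `F = F_mod`-data with `K/ℚ` Galois);
  without it, p495112's per-tuple transfer terms are the (height-type) correction.
* `shellBudget_nonneg` — every summand of the budget is `≥ 0` (`R_out ≤ R_in`, abc-iut-rh2-w-2's `outerRadius_le_innerRadius`; `D ≥ 0`; `Pr ≥ 0`).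

HONEST FRAMING: an inequality between OUR typed objects at ONE instantiation with prescribed integer binders and an explicit finite-support
hypothesis; the link binders ↔ genuine datum is the kit certificate (computed ≠ proved); nothing here decides any cell at genuine data, asserts or
denies [IUTchIII] Cor. 3.12, or bears on abc; no side taken on any author (Mochizuki / Scholze–Stix / Joshi / Dupuy–Hilado); typed ≠ proved for
anything not named as a theorem; instantiated ≠ endorsed. [claim: Mochizuki2012, status: disputed] for every quoted construction.
[cite: DupuyHilado2025, §3.6, §3.9, §4.12] [cite: Mochizuki2012, IUTchIII Cor. 3.12 p. 173–175, Prop. 3.9 (i)–(iii) p. 115–116; IUTchIV Prop. 1.2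
(i)(ii) p. 10, Thm. 1.10 Step (v) p. 27–28] [cite: NeukirchANT1999, Ch. II (5.5)]
-/

noncomputable section

open Set Function NumberField IsDedekindDomain
open scoped Pointwise

namespace Summit.ABC.IUTFork.Repair.RHCreditShellBudgetDatum

open Summit.ABC.IUTFork.Thm311 Summit.ABC.IUTFork.Thm311.Real Summit.ABC.IUTFork.Cor312 Summit.ABC.IUTFork.Cor312.Setting
  Summit.ABC.IUTFork.Cor312Vol Literature.IUT.LogThetaLattice Literature.IUT.LogVolume
  Literature.NumberTheory.GaloisRepresentations.Ultrametric
  Summit.ABC.IUTFork.Repair.RH.SigmaLicence Summit.ABC.IUTFork.Repair.RHCellSlackExactStatement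
  Summit.ABC.IUTFork.Repair.RHCreditShellBudgetSetting

variable {F : Type} [Field F] [NumberField F] (X : PilotData F) {logv : PadicLogs F} (hlog : LogvAnalytic logv)
  (M : Type) [Field M] [NumberField M]
  (archPk : ∀ (j : (thetaIndex X).Label) (vQ : (thetaIndex X).VQ), Set ((logShellsDH X logv).Packet j vQ))
  (archSub : ∀ (j : (thetaIndex X).Label) (v : (thetaIndex X).V),
    Set ((logShellsDH X logv).Packet j ((thetaIndex X).over v)))
  (Ψ : ℤ → ∀ v : (thetaIndex X).V, v ∈ (thetaIndex X).Vbad → Set ((logShellsDH X logv).StarPacket v))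
  (act : ℤ → ∀ v : (thetaIndex X).V, v ∈ (thetaIndex X).Vbad →
    (logShellsDH X logv).StarPacket v → Module.End ℚ ((logShellsDH X logv).StarPacket v))
  (Mmod : ℤ → ∀ j : (thetaIndex X).LabelStar, Set ((logShellsDH X logv).GlobalPacket j.1))
  (region : ℤ → ∀ j : (thetaIndex X).LabelStar, FinDivisor M → ∀ vQ : (thetaIndex X).VQ,
    Set ((logShellsDH X logv).Packet j.1 vQ))
  (n : ℤ) {HT : Type} {LogLink : HT → HT → Type} {IsFull : ∀ {s t : HT}, LogLink s t → Prop}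
  (lat : LGPGaussianLogThetaLattice LogLink IsFull)
  {Frd : Type} {IsoF : Frd → Frd → Type} {Ob : Frd → Type} {realify : Frd → Frd} {Strip : Type}
  {IsoS : Strip → Strip → Type} {Mv : ∀ v : (thetaIndex X).V, v ∈ (thetaIndex X).Vbad → Type}
  [∀ v h, Monoid (Mv v h)]
  (sig : GlobalLGPFrobenioidSignature (thetaIndex X).lstar (thetaIndex X).V (· ∈ (thetaIndex X).Vbad)
    Frd IsoF Ob realify Strip IsoS Mv)
  (split : SplittingMonoids Mv) {ObΔ : Type} {N : ∀ v : (thetaIndex X).V, v ∈ (thetaIndex X).Vbad → Type}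
  [∀ v h, Monoid (N v h)] (qData : QPilotData ObΔ N)
  (t : ∀ (pp : Nat.Primes) (_ : Fin X.lstar) (x : (thetaIndex X).Fibre (.inr pp)),
    haveI : Fact (pp : ℕ).Prime := ⟨pp.2⟩; kOf X pp.1 x)
  (tq : ∀ (pp : Nat.Primes) (x : (thetaIndex X).Fibre (.inr pp)), haveI : Fact (pp : ℕ).Prime := ⟨pp.2⟩; kOf X pp.1 x)
  (ht0 : ∀ pp i x, t pp i x ≠ 0)
  (ht1 : ∀ (pp : Nat.Primes) (i : Fin X.lstar) (x : (thetaIndex X).Fibre (.inr pp)),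
    haveI : Fact (pp : ℕ).Prime := ⟨pp.2⟩; placeOf X pp.1 x ∉ X.S → ‖t pp i x‖ = 1)
  (htq0 : ∀ pp x, tq pp x ≠ 0)
  (htq1 : ∀ (pp : Nat.Primes) (x : (thetaIndex X).Fibre (.inr pp)),
    haveI : Fact (pp : ℕ).Prime := ⟨pp.2⟩; placeOf X pp.1 x ∉ X.S → ‖tq pp x‖ = 1)

/-- **`−cellDeficit_{i,p} = logvol(ⁿ˒°𝒰_{i+1,p}) − qLocal_{i+1,p}`** at the sharp setting (its column is `n`, abc-iut-c312-7's `settingPrVolSharp_n`).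
[claim: Mochizuki2012, status: disputed] -/
theorem neg_cellDeficit_settingPrVolSharp_inr_eq (i : Fin (thetaIndex X).lstar) (pp : Nat.Primes) :
    -cellDeficit (settingPrVolSharp X hlog M archPk archSub Ψ act Mmod region n lat sig split qData tq t htq0 htq1) i (.inr pp) =
      ((situationPrVol X hlog M archPk archSub Ψ act Mmod region).D n).logvol _ (.inr pp)
          ((settingPrVolSharp X hlog M archPk archSub Ψ act Mmod region n lat sig split qData tq t htq0 htq1).thetaHull
            (Setting.labelSucc i) (.inr pp)) -
        (settingPrVolSharp X hlog M archPk archSub Ψ act Mmod region n lat sig split qData tq t htq0 htq1).qLocal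
          (Setting.labelSucc i) (.inr pp) := by
  unfold cellDeficit
  rw [settingPrVolSharp_n]
  ring

section Datum

variable
  /- an exact content family at EVERY `(i, p)` (p481438's / abc-iut-rh2-q2-eq's binders) -/
  (m : ∀ (i : Fin (thetaIndex X).lstar) (pp : Nat.Primes),
    ((thetaIndex X).Caps (Setting.labelSucc i) → (thetaIndex X).Fibre (.inr pp)) → ℤ)
  (hm0 : ∀ (i : Fin (thetaIndex X).lstar) (pp : Nat.Primes)
      (e : (thetaIndex X).Caps (Setting.labelSucc i) → (thetaIndex X).Fibre (.inr pp)),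
    haveI : Fact (pp : ℕ).Prime := ⟨pp.2⟩;
    (⋃ a, iota pp.1 ((presAt X hlog pp).kk e) a (t pp i (e a)) •
        (normalizedPacket pp.1 ((presAt X hlog pp).kk e) : Set ((presAt X hlog pp).X e))) ⊆
      (((pp : ℕ) : ℚ_[pp]) ^ m i pp e) • (logPacket pp.1 ((presAt X hlog pp).kk e) : Set ((presAt X hlog pp).X e)))
  (hm1 : ∀ (i : Fin (thetaIndex X).lstar) (pp : Nat.Primes)
      (e : (thetaIndex X).Caps (Setting.labelSucc i) → (thetaIndex X).Fibre (.inr pp)),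
    haveI : Fact (pp : ℕ).Prime := ⟨pp.2⟩;
    ¬ (⋃ a, iota pp.1 ((presAt X hlog pp).kk e) a (t pp i (e a)) •
        (normalizedPacket pp.1 ((presAt X hlog pp).kk e) : Set ((presAt X hlog pp).X e))) ⊆
      (((pp : ℕ) : ℚ_[pp]) ^ (m i pp e + 1)) • (logPacket pp.1 ((presAt X hlog pp).kk e) : Set ((presAt X hlog pp).X e)))
  /- per-place binders at EVERY nonarchimedean place (p495112's block, indexed by the prime as well) -/
  (ϖ : ∀ (pp : Nat.Primes) (x : (thetaIndex X).Fibre (.inr pp)), haveI : Fact (pp : ℕ).Prime := ⟨pp.2⟩; ((presAt X hlog pp).k x)ˣ)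
  (hϖ : ∀ (pp : Nat.Primes) (x : (thetaIndex X).Fibre (.inr pp)), haveI : Fact (pp : ℕ).Prime := ⟨pp.2⟩; IsUniformizer (ϖ pp x))
  {D : ∀ pp : Nat.Primes, (thetaIndex X).Fibre (.inr pp) → ℕ}
  (hD : ∀ (pp : Nat.Primes) (x : (thetaIndex X).Fibre (.inr pp)), haveI : Fact (pp : ℕ).Prime := ⟨pp.2⟩;
    differentOrd pp.1 ((presAt X hlog pp).k x) = (D pp x : ℝ) / absRamificationIdx pp.1 ((presAt X hlog pp).k x))
  {cin cout : ∀ (pp : Nat.Primes) (x : (thetaIndex X).Fibre (.inr pp)), haveI : Fact (pp : ℕ).Prime := ⟨pp.2⟩; (presAt X hlog pp).k x}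
  (hin : ∀ (pp : Nat.Primes) (x : (thetaIndex X).Fibre (.inr pp)), haveI : Fact (pp : ℕ).Prime := ⟨pp.2⟩;
    ∀ o : (presAt X hlog pp).k x, ‖o‖ ≤ 1 → cin pp x * o ∈ logUnits ((presAt X hlog pp).k x))
  (hmax : ∀ (pp : Nat.Primes) (x : (thetaIndex X).Fibre (.inr pp)), haveI : Fact (pp : ℕ).Prime := ⟨pp.2⟩;
    ∃ (ϖ' : ((presAt X hlog pp).k x)ˣ) (w : (presAt X hlog pp).k x),
      IsUniformizer ϖ' ∧ w ∉ logUnits ((presAt X hlog pp).k x) ∧ ‖w‖ * ‖(ϖ' : (presAt X hlog pp).k x)‖ ≤ ‖cin pp x‖)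
  (houtΛ : ∀ (pp : Nat.Primes) (x : (thetaIndex X).Fibre (.inr pp)), haveI : Fact (pp : ℕ).Prime := ⟨pp.2⟩; cout pp x ∈ logUnits ((presAt X hlog pp).k x))
  (hdom : ∀ (pp : Nat.Primes) (x : (thetaIndex X).Fibre (.inr pp)), haveI : Fact (pp : ℕ).Prime := ⟨pp.2⟩; ∀ z ∈ logUnits ((presAt X hlog pp).k x), ‖z‖ ≤ ‖cout pp x‖)
  {Rin Rout : ∀ pp : Nat.Primes, (thetaIndex X).Fibre (.inr pp) → ℤ}
  (hRin : ∀ (pp : Nat.Primes) (x : (thetaIndex X).Fibre (.inr pp)), haveI : Fact (pp : ℕ).Prime := ⟨pp.2⟩; ‖cin pp x‖ = ‖(ϖ pp x : (presAt X hlog pp).k x)‖ ^ Rin pp x)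
  (hRout : ∀ (pp : Nat.Primes) (x : (thetaIndex X).Fibre (.inr pp)), haveI : Fact (pp : ℕ).Prime := ⟨pp.2⟩; ‖cout pp x‖ = ‖(ϖ pp x : (presAt X hlog pp).k x)‖ ^ Rout pp x)
  {MΘ : ∀ pp : Nat.Primes, Fin (thetaIndex X).lstar → (thetaIndex X).Fibre (.inr pp) → ℤ}
  {mq : ∀ pp : Nat.Primes, (thetaIndex X).Fibre (.inr pp) → ℤ}
  (hMΘ : ∀ (pp : Nat.Primes) (i : Fin (thetaIndex X).lstar) (x : (thetaIndex X).Fibre (.inr pp)),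
    haveI : Fact (pp : ℕ).Prime := ⟨pp.2⟩; ‖t pp i x‖ = ‖(ϖ pp x : (presAt X hlog pp).k x)‖ ^ MΘ pp i x)
  (hmq : ∀ (pp : Nat.Primes) (x : (thetaIndex X).Fibre (.inr pp)), haveI : Fact (pp : ℕ).Prime := ⟨pp.2⟩; ‖tq pp x‖ = ‖(ϖ pp x : (presAt X hlog pp).k x)‖ ^ mq pp x)

include hϖ hin hdom hRin hRout in
/-- **The budget summands are `≥ 0`**: `(1 + |S^±|·Σ_v Pr(v)·(D_v + R_in,v − R_out,v)/e_v)·log p ≥ 0` (`R_out ≤ R_in`: the inner ball lies in the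
shell, abc-iut-rh2-w-2's `RH.HullCellSliceLicence.outerRadius_le_innerRadius`; `D ≥ 0`; `Pr ≥ 0`; `log p > 0`). [folklore] -/
theorem shellBudget_nonneg (i : Fin (thetaIndex X).lstar) (pp : Nat.Primes) :
    haveI : Fact (pp : ℕ).Prime := ⟨pp.2⟩
    0 ≤ (1 + Fintype.card ((thetaIndex X).Caps (Setting.labelSucc i)) *
          ∑ v : ↥(placesOver F pp), weight F v.1 *
            (((D pp ((fibreEquivPlacesOver X pp).symm v) : ℝ) +
                (Rin pp ((fibreEquivPlacesOver X pp).symm v) - Rout pp ((fibreEquivPlacesOver X pp).symm v))) /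
              absRamificationIdx pp.1 ((presAt X hlog pp).k ((fibreEquivPlacesOver X pp).symm v)))) *
        Real.log pp := by
  haveI : Fact (pp : ℕ).Prime := ⟨pp.2⟩
  have hp1 : (1 : ℝ) < ((pp : ℕ) : ℝ) := by exact_mod_cast pp.2.one_lt
  refine mul_nonneg (add_nonneg zero_le_one (mul_nonneg (Nat.cast_nonneg _) (Finset.sum_nonneg fun v _ =>
    mul_nonneg (weight_nonneg F _) (div_nonneg ?_ (Nat.cast_nonneg _))))) (Real.log_pos hp1).le
  set x := (fibreEquivPlacesOver X pp).symm v
  have hG : Rout pp x ≤ Rin pp x :=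
    RH.HullCellSliceLicence.outerRadius_le_innerRadius (hϖ pp x) (hin pp x) (hdom pp x) (hRin pp x) (hRout pp x)
  have hG' : (Rout pp x : ℝ) ≤ Rin pp x := by exact_mod_cast hG
  have hD0 : (0 : ℝ) ≤ D pp x := Nat.cast_nonneg _
  linarith

include ht0 ht1 hm0 hm1 hϖ hD hin hmax houtΛ hdom hRin hRout hMΘ hmq in
/-- **THE NETTING CREDIT OF THE SHARP SETTING IS AT MOST THE CONDUCTOR-TYPE BUDGET (D-0121 R33(4), datum level).** For any finite set `S₀`
of primes off which the cells carry no credit (`0 ≤ cellDeficit_{i,p}`, `p ∉ S₀`), under the deep-slot condition at every tuple over every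
`p ∈ S₀`: `credit P ≤ PN(i ↦ Σ_{p ∈ S₀} (1 + |S^±_{i+2}|·Σ_{v ∣ p} (n_v/[F:ℚ])·(D_v + R_in,v − R_out,v)/e_v)·log p)` at
`P = settingPrVolSharp X …` — no local height on the right. [cite: DupuyHilado2025, §3.6, §3.9, §4.12]
[cite: Mochizuki2012, IUTchIII Cor. 3.12 p. 173–175, Prop. 3.9 (i)–(iii) p. 115–116; IUTchIV Prop. 1.2 (i)(ii) p. 10] [claim: Mochizuki2012, status: disputed] -/
theorem credit_settingPrVolSharp_le_shellBudget (S₀ : Finset Nat.Primes)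
    (hS₀ : ∀ (i : Fin (thetaIndex X).lstar) (pp : Nat.Primes), pp ∉ S₀ →
      0 ≤ cellDeficit (settingPrVolSharp X hlog M archPk archSub Ψ act Mmod region n lat sig split qData tq t htq0 htq1) i (.inr pp))
    (hdeep : ∀ (i : Fin (thetaIndex X).lstar) (pp : Nat.Primes), pp ∈ S₀ →
      ∀ (e : (thetaIndex X).Caps (Setting.labelSucc i) → (thetaIndex X).Fibre (.inr pp)) (a : _),
        haveI : Fact (pp : ℕ).Prime := ⟨pp.2⟩
        (mq pp (e (Fin.last _)) : ℝ) / absRamificationIdx pp.1 ((presAt X hlog pp).k (e (Fin.last _))) ≤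
          (MΘ pp i (e a) : ℝ) / absRamificationIdx pp.1 ((presAt X hlog pp).k (e a))) :
    credit (settingPrVolSharp X hlog M archPk archSub Ψ act Mmod region n lat sig split qData tq t htq0 htq1) ≤
      processionNormalized (fun i : Fin (thetaIndex X).lstar => ∑ pp ∈ S₀, haveI : Fact (pp : ℕ).Prime := ⟨pp.2⟩;
        (1 + Fintype.card ((thetaIndex X).Caps (Setting.labelSucc i)) *
            ∑ v : ↥(placesOver F pp), weight F v.1 *
              (((D pp ((fibreEquivPlacesOver X pp).symm v) : ℝ) +
                  (Rin pp ((fibreEquivPlacesOver X pp).symm v) - Rout pp ((fibreEquivPlacesOver X pp).symm v))) /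
                absRamificationIdx pp.1 ((presAt X hlog pp).k ((fibreEquivPlacesOver X pp).symm v)))) *
          Real.log pp) := by
  unfold credit processionNormalized
  refine div_le_div_of_nonneg_right (Finset.sum_le_sum fun i _ => ?_) (Nat.cast_nonneg _)
  -- archimedean cells carry no credit
  have harch : ∑ᶠ vQ : (thetaIndex X).VQ,
      max (-cellDeficit (settingPrVolSharp X hlog M archPk archSub Ψ act Mmod region n lat sig split qData tq t htq0 htq1) i vQ) 0 =
      ∑ᶠ pp : Nat.Primes,
        max (-cellDeficit (settingPrVolSharp X hlog M archPk archSub Ψ act Mmod region n lat sig split qData tq t htq0 htq1) i (.inr pp)) 0 :=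
    finsum_sum_eq_finsum_inr _ fun u => by
      show max (-cellDeficit (settingPrVolSharp X hlog M archPk archSub Ψ act Mmod region n lat sig split qData tq t htq0 htq1) i (.inl u)) 0 = 0
      rw [RH.SigmaStrataEq.cellDeficit_settingPrVolSharp_inl X hlog M archPk archSub Ψ act Mmod region n lat sig split qData t tq htq0 htq1 i u,
        neg_zero, max_self]
  rw [harch]
  -- the credit is supported on `S₀`
  have hsupp : (Function.support fun pp : Nat.Primes =>
      max (-cellDeficit (settingPrVolSharp X hlog M archPk archSub Ψ act Mmod region n lat sig split qData tq t htq0 htq1) i (.inr pp)) 0) ⊆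
      (S₀ : Set Nat.Primes) := by
    intro pp hpp
    by_contra hnot
    exact hpp (max_eq_right (by linarith [hS₀ i pp hnot]))
  rw [finsum_eq_sum_of_support_subset _ hsupp]
  refine Finset.sum_le_sum fun pp hpp => max_le ?_ (shellBudget_nonneg X hlog ϖ hϖ hin hdom hRin hRout i pp)
  rw [neg_cellDeficit_settingPrVolSharp_inr_eq]
  exact cellSlack_settingPrVolSharp_le_shellBudget_places_of_deep X hlog M archPk archSub Ψ act Mmod region n lat sig split qData t tq ht0 ht1
    htq0 htq1 i pp (m i pp) (hm0 i pp) (hm1 i pp) (ϖ pp) (hϖ pp) (hD pp) (hin pp) (hmax pp) (houtΛ pp) (hdom pp) (hRin pp) (hRout pp)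
    (hMΘ pp i) (hmq pp) (hdeep i pp hpp)

end Datum

end Summit.ABC.IUTFork.Repair.RHCreditShellBudgetDatum

end
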